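import Summits.QuantumAdvantage.QuantumAdvantage.Theses.CubicForrelation
import Summits.QuantumAdvantage.QuantumAdvantage.Theorems.CubicForrelationNearExactIsExactDerivDegree
import Summits.QuantumAdvantage.QuantumAdvantage.Theorems.CubicForrelationNearExactIsExactRmWeight
import Summits.QuantumAdvantage.QuantumAdvantage.Theorems.CubicForrelationNearExactIsExactMmNormalForm
import Summits.QuantumAdvantage.QuantumAdvantage.Theorems.CubicForrelationNearExactIsExactMmWalsh
import Summits.QuantumAdvantage.QuantumAdvantage.Theorems.CubicForrelationNearExactIsExactMmFormCeiling
import Summits.QuantumAdvantage.QuantumAdvantage.Theorems.CubicForrelationNearExactIsExactAmmNormalForm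
import Summits.QuantumAdvantage.QuantumAdvantage.Theorems.CubicForrelationNearExactIsExactAmmWalsh
import Summits.QuantumAdvantage.QuantumAdvantage.Theorems.CubicForrelationNearExactIsExactFourPoint
import Summits.QuantumAdvantage.QuantumAdvantage.Theorems.CubicForrelationNearExactIsExactRankTwoPencil
import Summits.QuantumAdvantage.QuantumAdvantage.Theorems.CubicForrelationNearExactIsExactAmmAccounting
import Summits.QuantumAdvantage.QuantumAdvantage.Theorems.CubicForrelationNearExactIsExactAmmCeiling

/-!
# Crux `CubicForrelation.NearExactIsExact` (stmt-QuantumAdvantage-14043) — line `codim-two-isolation`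
# (forward ladder G4, rung k = 2 of the relative-M-subspace ladder)

Crux (route `CubicForrelation`, rank 2; verbatim shape):
`∃ θ < 1, ∀ n, Even n → ∀ f g : (Fin n → Bool) → Bool, IsDegLeFun 3 f → IsDegLeFun 3 g → θ < Φ(f,g) → Φ(f,g) = 1`.

## The ladder (parameter = RELATIVE DEFECT `k` of the `g`-side)

`HasRelMSubspace k g`: `g` (on `n = m + m` bits) is affine on every coset of an xor-closed `V ∋ 0` with `|V|²·4ᵏ = 2ⁿ`
(`dim V = m − k`).  `k = 0` is the lead's `HasMSubspace` (Maiorana–McFarland SHAPE), `k = 1` the lead's `HasAMSubspace`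
(almost-MM shape, the class `GMM_{m+1}`), `k = 2` is `GMM_{m+2}` ⊇ the 4-concatenations of MM functions
(arXiv:2508.14265, 2304.13432, 2404.16220) — the place the disprover and the lead (NOTES l.205-208) name as the next regime.

`RelIsolation k := ∃ θ < 1, ∀ m f g cubic on m+m bits, HasRelMSubspace k g → θ < Φ(f,g) → Φ(f,g) = 1`
(isolation of exactness RESTRICTED to relative defect `k` on one side; each rung is a consequence of the crux — drop the
shape hypothesis — and no rung gives the crux: pairs of large relative defect on both sides are untouched).

* rung 0 — PROVED (`relIsolation_zero`, θ = 31/32): landed `stub_mmNormalForm` + `stub_mmWalsh` + `stub_mmFormCeiling`.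
* rung 1 — PROVED (`relIsolation_one`, θ = 1 − 2⁻¹⁰): landed `stub_ammNormalForm` + `stub_ammCeiling` (p129733) and rung 0.
* rung 2 — OPEN = THIS LINE (`CodimTwoIsolation`): `stub_relTwoNormalForm` (L, known type) + `stub_relTwoWalsh` (M, identity)
  + `stub_relTwoFormCeiling` (XL, open: 16-point Walsh concentration of cubic fibre functions on 4-flats + affine pencils of
  alternating forms of rank ≤ 4 + RM-weight granularity), composed in `codimTwoIsolation_of` (sorry-free) with rungs 0, 1.
* gap after the rung — `stub_largeDefectGap`: the crux restricted to pairs with NO relative M-subspace of codimension 2 on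
  EITHER side (the lead's open core stubs `stub_bentBandLarge` / `stub_nonBentBand` may take these as extra antecedents).

`NearExactIsExact_of : N2 → W2 → C2 → G → NearExactIsExact` is sorry-free and concludes the crux BY NAME
(`by_cases` on the relative defect of `g`, then of `f` via `Φ(f,g) = Φ(g,f)`, θ := max).
-/

set_option linter.dupNamespace false -- D-0017: single-problem summit ⇒ `QuantumAdvantage.QuantumAdvantage` by design

noncomputable section

namespace Summit.QuantumAdvantage.QuantumAdvantage.Cruxes.NearExactIsExact.CodimTwoIsolation

open Finset
open Literature.Computability.QuantumComplexity
open Literature.Computability.QuantumComplexity.BuzetChailloux (bxor zeroVec signOf_sq)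
open Summit.QuantumAdvantage.QuantumAdvantage.Theses.CubicForrelation (NearExactIsExact)

variable {n : ℕ}

/-! ## §0 Vocabulary -/

/-- `g` has a **relative M-subspace of codimension `k`**: an xor-closed finset `V ∋ 0` with `|V|²·4ᵏ = 2ⁿ`
(`dim V = n/2 − k`) on every coset of which `g` is affine (all second differences along `V` vanish).
`k = 0`: the lead's `HasMSubspace` (`|V|² = 2ⁿ`); `k = 1`: the lead's `HasAMSubspace` (`4|V|² = 2ⁿ`). -/
def HasRelMSubspace (k : ℕ) (g : (Fin n → Bool) → Bool) : Prop :=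
  ∃ V : Finset (Fin n → Bool), zeroVec ∈ V ∧ (∀ x ∈ V, ∀ y ∈ V, bxor x y ∈ V) ∧ V.card * V.card * 4 ^ k = 2 ^ n ∧
    ∀ u ∈ V, ∀ v ∈ V, ∀ y, (g y ^^ g (bxor y u) ^^ g (bxor y v) ^^ g (bxor y (bxor u v))) = false

/-- **Rung `k` of the ladder**: isolation of exactness for cubic pairs whose `g`-side has relative defect `k`. -/
def RelIsolation (k : ℕ) : Prop :=
  ∃ θ : ℝ, θ < 1 ∧ ∀ (m : ℕ) (f g : (Fin (m + m) → Bool) → Bool), IsDegLeFun 3 f → IsDegLeFun 3 g →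
    HasRelMSubspace k g → θ < forrelation f g → forrelation f g = 1

/-- **The rung filed by this line** (`k = 2`; `k = 0, 1` are theorems below). -/
def CodimTwoIsolation : Prop := RelIsolation 2

/-- **The gap after the rung**: the crux on pairs with no codimension-2 relative M-subspace on either side. -/
def LargeDefectGap : Prop :=
  ∃ θ : ℝ, θ < 1 ∧ ∀ (m : ℕ) (f g : (Fin (m + m) → Bool) → Bool), IsDegLeFun 3 f → IsDegLeFun 3 g →
    ¬ HasRelMSubspace 2 f → ¬ HasRelMSubspace 2 g → θ < forrelation f g → forrelation f g = 1

/-! ## §1 Registered stubs -/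

/-- **stub_relTwoNormalForm** (N2; KNOWN type — Dillon/McFarland straightening one level below `stub_ammNormalForm`,
size L). If the cubic `g` on `(a+2)+(a+2)` bits has a relative M-subspace `V` of codimension 2 (`dim V = a`), a LINEAR
change of coordinates sending `V` to the `y₁`-block (and the transpose-inverse change on the `f`-side, which preserves
`x·y`, hence `Φ`, and all degrees) puts the pair in the sign form `(−1)^{g₁(y₁ ‖ y₂)} = (−1)^{y₁·φ(y₂)}(−1)^{h(y₂)}`,
`y₁ ∈ 𝔽₂^a`, `y₂ ∈ 𝔽₂^{a+4}`, `φ` coordinatewise quadratic (a `y₁`-derivative of the cubic `g₁`, `stub_derivDegree`),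
`h = g₁(0 ‖ ·)` cubic; relative M-subspaces of `g₁` pull back to `g` (last clause, used for the escape disjuncts of C2).
Why plausibly true: verbatim the landed AN (`Theorems/…AmmNormalForm.lean`, `an_exists_linearEquiv`) with `a+1 ↦ a+2`.
Leans on: `dnf_exists_submodule`, `dnf_finrank_eq`, `dnf_exists_linearEquiv` (DillonNormalForm), `nf_isDegLeFun_mulVec`,
landed `stub_derivDegree`. -/
theorem stub_relTwoNormalForm :
    ∀ (a : ℕ) (f g : (Fin ((a + 2) + (a + 2)) → Bool) → Bool), IsDegLeFun 3 f → IsDegLeFun 3 g →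
      HasRelMSubspace 2 g →
      ∃ (f₁ g₁ : (Fin (a + (a + 4)) → Bool) → Bool) (φ : (Fin (a + 4) → Bool) → (Fin a → Bool))
        (h : (Fin (a + 4) → Bool) → Bool),
        IsDegLeFun 3 f₁ ∧ (∀ i : Fin a, IsDegLeFun 2 (fun y => φ y i)) ∧ IsDegLeFun 3 h ∧
        (∀ (y₁ : Fin a → Bool) (y₂ : Fin (a + 4) → Bool),
          signOf (g₁ (Fin.append y₁ y₂)) = twist y₁ (φ y₂) * signOf (h y₂)) ∧
        forrelation f₁ g₁ = forrelation f g ∧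
        (∀ k : ℕ, HasRelMSubspace k g₁ → HasRelMSubspace k g) := by
  sorry

/-- **stub_relTwoWalsh** (W2; KNOWN — McFarland's Walsh sum one level below the landed `stub_ammWalsh`, size M): for `g` in
the level-2 sign form, summing over the linear block `y₁ ∈ 𝔽₂^a` first gives `W_g(x₁ ‖ x₂) = 2^a Σ_{y₂ : φ y₂ = x₁}
(−1)^{h(y₂)}(−1)^{x₂·y₂}`, hence (with `n = 2a+4`, `2^{3n/2} = 2^a·2^{2a+6}`)
`Φ(f,g) = 2^{−(2a+6)} Σ_{y₂} (−1)^{h(y₂)} Σ_{x₂} (−1)^{f(φ(y₂) ‖ x₂)}(−1)^{x₂·y₂}` — the average over `y₂` of the signed,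
`y₂`-twisted Walsh value of the cubic FIBRE FUNCTION `e_{x₁} := f(x₁ ‖ ·)` on `a+4` bits. A pure identity.
Leans on: `ForrelationDirectSum.sum_append`, `twist_append`, `Simon.sum_twist`, pattern `aw_walsh_signForm`/`aw_fsum_signForm`. -/
theorem stub_relTwoWalsh :
    ∀ (a : ℕ) (f g : (Fin (a + (a + 4)) → Bool) → Bool) (φ : (Fin (a + 4) → Bool) → (Fin a → Bool))
      (h : (Fin (a + 4) → Bool) → Bool),
      (∀ (y₁ : Fin a → Bool) (y₂ : Fin (a + 4) → Bool),
        signOf (g (Fin.append y₁ y₂)) = twist y₁ (φ y₂) * signOf (h y₂)) →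
      forrelation f g = ((2 : ℝ) ^ (2 * a + 6))⁻¹ *
        ∑ y₂ : Fin (a + 4) → Bool, signOf (h y₂) *
          ∑ x₂ : Fin (a + 4) → Bool, signOf (f (Fin.append (φ y₂) x₂)) * twist x₂ y₂ := by
  sorry

/-- **stub_relTwoFormCeiling** (C2; OPEN, HARDEST, size XL — the level-2 form ceiling, one level below the landed
`stub_ammCeiling`). Fed with the identity W2: there is `θ₂ < 1` such that for cubic `f`, coordinatewise-quadratic `φ`,
cubic `h` and `g` in level-2 sign form on `a + (a+4)` bits, `Φ(f,g) = 1 ∨ Φ(f,g) ≤ θ₂ ∨ g` has a relative M-subspace of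
codimension `1` or `0` (escape to the PROVED rungs). Mechanism foreseen (lead NOTES l.205-208, AMM proof one level up):
by W2, `Φ = E_{x₁} [2^{−(a+6)} Σ_{y₂ ∈ φ⁻¹(x₁)} (−1)^{h(y₂)} W_{e_{x₁}}(y₂)]`; Parseval on the cubic fibre function `e_{x₁}`
caps a fibre's contribution by `√|φ⁻¹(x₁)|/4`, so `Φ` near `1` forces almost all fibres to have EXACTLY 16 points carrying
Walsh mass `≈ 4·2^{a+4}` — the 16-POINT CONCENTRATION regime: a cubic whose `|W|`-mass on 16 points exceeds `(4−c)·2^K` is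
affine ⊕ a bent QUADRATIC in four linear forms (bent functions of 4 variables are quadratic) with Walsh support = that 4-flat
(the analogue of the landed `stub_fourPoint`, constant `15/8` of `2`); then the fibres of the quadratic map `φ` are 4-flats
whose direction spaces form an affine pencil of alternating-form data of rank ≤ 4 (analogue of `stub_rankTwoPencil`), and an
accounting step (analogue of `stub_ammAccounting`: bad fibres cost `≥ 2^{−O(1)}` each, RM-weight granularity
`stub_rmWeight` on words of bounded degree) gives `Φ = 1`, or `Φ ≤ θ₂`, or realignment of `V ⊕ (fibre directions)` into a
relative M-subspace of codimension ≤ 1. Why it might fail: the degree of the symplectic-basis correction grows with `k`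
(lead: "ceilings θ_k → 1, non-uniform") — harmless for ONE fixed `k = 2` unless a 4-concatenation family inside `GMM_{m+2}`
has `Φ → 1` (that would refute the rung AND the crux: cheapest falsifier, `kit` sweep over 4-concatenations of 6/8-bit MM
cubics). Uses `hf` essentially (Disproof §4). -/
theorem stub_relTwoFormCeiling :
    (∀ (a : ℕ) (f g : (Fin (a + (a + 4)) → Bool) → Bool) (φ : (Fin (a + 4) → Bool) → (Fin a → Bool))
      (h : (Fin (a + 4) → Bool) → Bool),
      (∀ (y₁ : Fin a → Bool) (y₂ : Fin (a + 4) → Bool),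
        signOf (g (Fin.append y₁ y₂)) = twist y₁ (φ y₂) * signOf (h y₂)) →
      forrelation f g = ((2 : ℝ) ^ (2 * a + 6))⁻¹ *
        ∑ y₂ : Fin (a + 4) → Bool, signOf (h y₂) *
          ∑ x₂ : Fin (a + 4) → Bool, signOf (f (Fin.append (φ y₂) x₂)) * twist x₂ y₂) →
    ∃ θ₂ : ℝ, θ₂ < 1 ∧
      ∀ (a : ℕ) (f g : (Fin (a + (a + 4)) → Bool) → Bool) (φ : (Fin (a + 4) → Bool) → (Fin a → Bool))
        (h : (Fin (a + 4) → Bool) → Bool),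
        IsDegLeFun 3 f → (∀ i : Fin a, IsDegLeFun 2 (fun y => φ y i)) → IsDegLeFun 3 h →
        (∀ (y₁ : Fin a → Bool) (y₂ : Fin (a + 4) → Bool),
          signOf (g (Fin.append y₁ y₂)) = twist y₁ (φ y₂) * signOf (h y₂)) →
        forrelation f g = 1 ∨ forrelation f g ≤ θ₂ ∨ HasRelMSubspace 1 g ∨ HasRelMSubspace 0 g := by
  sorry

/-- **stub_largeDefectGap** (G; OPEN, size XL — the gap after the rung = the crux core restricted to relative defect ≥ 3
on BOTH sides). There is `θ < 1` such that cubic pairs on `m + m` bits in which NEITHER `f` NOR `g` has a relative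
M-subspace of codimension 2 (hence, for `m ≥ 2`, none of codimension 0 or 1 either) and `Φ > θ` are exact. A consequence
of the crux (drop the two shape hypotheses); the honest statement behind it is the lead's NX ("near-exact ⇒ small relative
defect"), attacked in the lead's skeleton by `stub_bentBandLarge` / `stub_nonBentBand` (which may take `¬ HasRelMSubspace 2`
on both sides as extra antecedents once C2 lands) — this line does not claim a new mechanism for it. Why it might fail: a
non-MM near-bent cubic family of unbounded relative defect with `Φ → 1` (refutes the crux too). -/
theorem stub_largeDefectGap :
    ∃ θ : ℝ, θ < 1 ∧ ∀ (m : ℕ) (f g : (Fin (m + m) → Bool) → Bool), IsDegLeFun 3 f → IsDegLeFun 3 g →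
      ¬ HasRelMSubspace 2 f → ¬ HasRelMSubspace 2 g → θ < forrelation f g → forrelation f g = 1 := by
  sorry

/-! ## §2 The proved rungs `k = 0, 1` (sorry-free, from landed Theorems) -/

/-- `Φ(f,g) = Φ(g,f)` (the twist is symmetric). [folklore; as in the lead skeleton] -/
theorem forrelation_comm (f g : (Fin n → Bool) → Bool) : forrelation f g = forrelation g f := by
  unfold forrelation
  congr 1
  rw [Finset.sum_comm]
  refine Finset.sum_congr rfl fun y _ => Finset.sum_congr rfl fun x _ => ?_
  rw [twist_comm]; ring

open Summit.QuantumAdvantage.QuantumAdvantage.Theorems.CubicForrelation.NearExactIsExact in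
/-- **Rung 0 as a ceiling** (landed N, F1, F2 fed with D, R): `HasRelMSubspace 0 g`, `f g` cubic ⇒ `Φ = 1 ∨ Φ ≤ 31/32`. -/
theorem mmShapeCeiling (m : ℕ) (f g : (Fin (m + m) → Bool) → Bool) (hf : IsDegLeFun 3 f) (hg : IsDegLeFun 3 g)
    (hM : HasRelMSubspace 0 g) : forrelation f g = 1 ∨ forrelation f g ≤ 31 / 32 := by
  obtain ⟨V, hV0, hVx, hVc, hD4⟩ := hM
  rw [pow_zero, mul_one] at hVc
  obtain ⟨f₁, g₁, π, h, hf₁, hπ, hh, hsign, hΦ⟩ :=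
    stub_mmNormalForm stub_derivDegree m f g hf hg ⟨V, hV0, hVx, hVc, hD4⟩
  rw [← hΦ]
  exact stub_mmFormCeiling stub_derivDegree (stub_rmWeight stub_derivDegree) stub_mmWalsh m f₁ g₁ π h hf₁ hπ hh hsign

/-- **Rung 0** (`RelIsolation 0`, θ = 31/32): PROVED. -/
theorem relIsolation_zero : RelIsolation 0 := by
  refine ⟨31 / 32, by norm_num, ?_⟩
  intro m f g hf hg hM hθ
  rcases mmShapeCeiling m f g hf hg hM with h | h
  · exact h
  · exfalso; linarith

open Summit.QuantumAdvantage.QuantumAdvantage.Theorems.CubicForrelation.NearExactIsExact in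
/-- **Rung 1 as a ceiling** (landed AN, AC fed with D, R, AW, FP, RP, AA): `HasRelMSubspace 1 g`, `f g` cubic ⇒
`Φ = 1 ∨ Φ ≤ 1 − 2⁻¹⁰ ∨ HasRelMSubspace 0 g`. -/
theorem ammShapeCeiling (m : ℕ) (f g : (Fin (m + m) → Bool) → Bool) (hf : IsDegLeFun 3 f) (hg : IsDegLeFun 3 g)
    (hAM : HasRelMSubspace 1 g) : forrelation f g = 1 ∨ forrelation f g ≤ 1 - 1 / 1024 ∨ HasRelMSubspace 0 g := by
  obtain ⟨V, hV0, hVx, hVc, hD4⟩ := hAM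
  rw [pow_one] at hVc
  obtain ⟨a, rfl⟩ : ∃ a, m = a + 1 := by
    have h4 : 4 ∣ 2 ^ (m + m) := ⟨V.card * V.card, by rw [← hVc]; ring⟩
    refine ⟨m - 1, ?_⟩
    rcases Nat.lt_or_ge m 1 with hm | hm
    · interval_cases m; norm_num at h4
    · omega
  obtain ⟨f₁, g₁, φ, h, hf₁, hφ, hh, hsign, hΦ, hback⟩ :=
    stub_ammNormalForm stub_derivDegree a f g hf hg ⟨V, hV0, hVx, hVc, hD4⟩
  rcases stub_ammCeiling stub_derivDegree (stub_rmWeight stub_derivDegree) stub_ammWalsh stub_fourPoint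
      stub_rankTwoPencil stub_ammAccounting a f₁ g₁ φ h hf₁ hφ hh hsign with h1 | h2 | h3
  · left; rw [← hΦ]; exact h1
  · right; left; rw [← hΦ]; exact h2
  · right; right
    obtain ⟨V', hV0', hVx', hVc', hD4'⟩ := hback h3
    exact ⟨V', hV0', hVx', by rw [pow_zero, mul_one]; exact hVc', hD4'⟩

/-- **Rung 1** (`RelIsolation 1`, θ = 1 − 2⁻¹⁰): PROVED — the BC5 witness of the ladder (first rung below the filed one). -/
theorem relIsolation_one : RelIsolation 1 := by
  refine ⟨1 - 1 / 1024, by norm_num, ?_⟩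
  intro m f g hf hg hAM hθ
  rcases ammShapeCeiling m f g hf hg hAM with h | h | h
  · exact h
  · exfalso; linarith
  · rcases mmShapeCeiling m f g hf hg h with h' | h'
    · exact h'
    · exfalso; linarith

/-! ## §3 Compositions (sorry-free) -/

/-- **The rung from its parts**: N2, W2, C2 (and the proved rungs 0, 1 for the escape disjuncts) ⇒ `CodimTwoIsolation`. -/
theorem codimTwoIsolation_of (hN : type_of% stub_relTwoNormalForm) (hW : type_of% stub_relTwoWalsh)
    (hC : type_of% stub_relTwoFormCeiling) : CodimTwoIsolation := by
  obtain ⟨θ₀, hθ₀, h0⟩ := relIsolation_zero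
  obtain ⟨θ₁, hθ₁, h1⟩ := relIsolation_one
  obtain ⟨θ₂, hθ₂, h2⟩ := hC hW
  refine ⟨max θ₀ (max θ₁ θ₂), max_lt hθ₀ (max_lt hθ₁ hθ₂), ?_⟩
  intro m f g hf hg hV hθ
  have hθ0 : θ₀ < forrelation f g := lt_of_le_of_lt (le_max_left _ _) hθ
  have hθ1 : θ₁ < forrelation f g := lt_of_le_of_lt ((le_max_left _ _).trans (le_max_right _ _)) hθ
  have hθ2 : θ₂ < forrelation f g := lt_of_le_of_lt ((le_max_right _ _).trans (le_max_right _ _)) hθ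
  obtain ⟨a, rfl⟩ : ∃ a, m = a + 2 := by
    obtain ⟨V, -, -, hVc, -⟩ := hV
    have h16 : 16 ∣ 2 ^ (m + m) := ⟨V.card * V.card, by rw [← hVc]; ring⟩
    refine ⟨m - 2, ?_⟩
    rcases Nat.lt_or_ge m 2 with hm | hm
    · interval_cases m <;> norm_num at h16
    · omega
  obtain ⟨f₁, g₁, φ, h, hf₁, hφ, hh, hsign, hΦ, hback⟩ := hN a f g hf hg hV
  rcases h2 a f₁ g₁ φ h hf₁ hφ hh hsign with h' | h' | h' | h'
  · rw [← hΦ]; exact h'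
  · exfalso; rw [hΦ] at h'; linarith
  · exact h1 (a + 2) f g hf hg (hback 1 h') hθ1
  · exact h0 (a + 2) f g hf hg (hback 0 h') hθ0

/-- **Rung + gap ⇒ crux** (`by_cases` on the relative defect of `g`, then of `f` via `Φ(f,g) = Φ(g,f)`; θ := max). -/
theorem nearExact_of_rung_of_gap (hR : CodimTwoIsolation) (hG : LargeDefectGap) : NearExactIsExact := by
  obtain ⟨θ₂, hθ₂, h2⟩ := hR
  obtain ⟨θ₃, hθ₃, h3⟩ := hG
  unfold NearExactIsExact
  refine ⟨max θ₂ θ₃, max_lt hθ₂ hθ₃, ?_⟩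
  intro n hn f g hf hg hθ
  obtain ⟨m, rfl⟩ := hn
  have hθ2 : θ₂ < forrelation f g := lt_of_le_of_lt (le_max_left _ _) hθ
  have hθ3 : θ₃ < forrelation f g := lt_of_le_of_lt (le_max_right _ _) hθ
  by_cases hg2 : HasRelMSubspace 2 g
  · exact h2 m f g hf hg hg2 hθ2
  by_cases hf2 : HasRelMSubspace 2 f
  · rw [forrelation_comm] at hθ2 ⊢
    exact h2 m g f hg hf hf2 hθ2
  exact h3 m f g hf hg hf2 hg2 hθ3

/-- **Proof of the crux from the registered stubs, BY NAME.** -/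
theorem NearExactIsExact_of (hN : type_of% stub_relTwoNormalForm) (hW : type_of% stub_relTwoWalsh)
    (hC : type_of% stub_relTwoFormCeiling) (hG : type_of% stub_largeDefectGap) :
    Summit.QuantumAdvantage.QuantumAdvantage.Theses.CubicForrelation.NearExactIsExact :=
  nearExact_of_rung_of_gap (codimTwoIsolation_of hN hW hC) hG

/-- The crux, instantiated with the four registered stubs (closed = false until they land). -/
theorem NearExactIsExact_of_stubs : Summit.QuantumAdvantage.QuantumAdvantage.Theses.CubicForrelation.NearExactIsExact :=
  NearExactIsExact_of stub_relTwoNormalForm stub_relTwoWalsh stub_relTwoFormCeiling stub_largeDefectGap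

/-! ## §4 On-path certificate: the rung and the gap are consequences of the crux -/

/-- `NearExactIsExact → RelIsolation k` for every `k` (drop the shape hypothesis): the rung is ON the ladder. -/
theorem relIsolation_of_crux (h : NearExactIsExact) (k : ℕ) : RelIsolation k := by
  obtain ⟨θ, hθ, h⟩ := h
  exact ⟨θ, hθ, fun m f g hf hg _ hlt => h (m + m) ⟨m, rfl⟩ f g hf hg hlt⟩

/-- `NearExactIsExact → LargeDefectGap` (drop the two shape hypotheses). -/
theorem largeDefectGap_of_crux (h : NearExactIsExact) : LargeDefectGap := by
  obtain ⟨θ, hθ, h⟩ := h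
  exact ⟨θ, hθ, fun m f g hf hg _ _ hlt => h (m + m) ⟨m, rfl⟩ f g hf hg hlt⟩

end Summit.QuantumAdvantage.QuantumAdvantage.Cruxes.NearExactIsExact.CodimTwoIsolation
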